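import Literature.AnabelianGeometry.SemiGraphs.PreimageComponents
import HarnessLib

/-!
# Preimage components are closed under incidence ([SemiAnbd] §2, Cor. 2.7 (i) p. 30)

Mochizuki, *Semi-graphs of anabelioids*, Publ. RIMS **42** (2006), §2, proof of Cor. 2.7 (i), p. 30
("a connected component `ℋ″` of `ℋ′`") [cite: MochizukiSemiAnbd2006, Cor. 2.7(i) p.30].
PROOF-ONLY (abc-iut cell, L3 row «D3 discharge», abc-iut-L6-t17; brick M1b over
`PreimageComponents.lean`): a preimage component `K` of `φ⁻¹(ℍ)` contains every edge over `ℍ` one of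
whose branches abuts to a vertex of `K` (`Hom.IsPreimageComponent.mem_edges_of_abuts`, proper base,
`ℍ` a graph), and every vertex to which a branch of one of its edges abuts
(`Hom.IsPreimageComponent.mem_verts_of_abuts`).  These are the two incidence closures the
`B(𝒢_ℍ)`-sub-object attached to `K` needs (KEY identity of the (D3) count).
-/

namespace Literature.AnabelianGeometry.SemiGraphs

open CategoryTheory

universe v₁ u₁ u

namespace SemiGraphOfAnabelioids

open SemiGraph

variable {𝒢 𝒢' : SemiGraphOfAnabelioids.{v₁, u₁, u}}

/-- A preimage component contains every vertex to which a branch of one of its edges abuts (it is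
a sub-GRAPH). [cite: MochizukiSemiAnbd2006, Cor. 2.7(i) p.30] -/
theorem Hom.IsPreimageComponent.mem_verts_of_abuts {φ : Hom 𝒢' 𝒢} {H : 𝒢.graph.Subgraph}
    {K : 𝒢'.graph.Subgraph} (hK : φ.IsPreimageComponent H K) {b : 𝒢'.graph.Branch}
    (hb : 𝒢'.graph.edgeOf b ∈ K.edges) {u : 𝒢'.graph.Vertex} (hu : 𝒢'.graph.abuts b = some u) :
    u ∈ K.verts := by
  obtain ⟨ũ, hũ⟩ := Option.isSome_iff_exists.mp (hK.2.1.abuts_isSome ⟨b, hb⟩)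
  have h1 : 𝒢'.graph.abuts b = some ũ.1 := (Subgraph.abuts_eq_some_iff K ⟨b, hb⟩ ũ).mp hũ
  rw [hu] at h1
  rw [Option.some.inj h1]
  exact ũ.2

/-- A preimage component contains every edge over `ℍ` one of whose branches abuts to one of its
vertices (proper base, `ℍ` a graph): the component is the reachability class of that vertex inside
`φ⁻¹(ℍ)`, and the edge is two incidences away. [cite: MochizukiSemiAnbd2006, Cor. 2.7(i) p.30] -/
theorem Hom.IsPreimageComponent.mem_edges_of_abuts {φ : Hom 𝒢' 𝒢} {H : 𝒢.graph.Subgraph}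
    {K : 𝒢'.graph.Subgraph} (hK : φ.IsPreimageComponent H K) (hprop : SemiGraph.IsProper φ.base)
    (hHg : H.toSemiGraph.IsGraph) {w : 𝒢'.graph.Vertex} (hw : w ∈ K.verts) {b : 𝒢'.graph.Branch}
    (hb : 𝒢'.graph.abuts b = some w) (he : φ.base.edgeMap (𝒢'.graph.edgeOf b) ∈ H.edges) :
    𝒢'.graph.edgeOf b ∈ K.edges := by
  classical
  have hwH : φ.base.vertexMap w ∈ H.verts := hK.2.2.2.1 hw
  -- the reachability class `C` of `w` is a preimage component containing `w`, hence equals `K`,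
  -- and it contains the edge of `b` (reachable: `w — b — e(b)`)
  let D : 𝒢'.graph.Subgraph := ⟨φ.base.vertexMap ⁻¹' H.verts, φ.base.edgeMap ⁻¹' H.edges⟩
  let n₀ : D.toSemiGraph.Node := Sum.inl ⟨w, hwH⟩
  let C : 𝒢'.graph.Subgraph :=
    ⟨{u | ∃ hu : φ.base.vertexMap u ∈ H.verts,
        D.toSemiGraph.subdivision.Reachable n₀ (Sum.inl ⟨u, hu⟩)},
      {e | ∃ he : φ.base.edgeMap e ∈ H.edges,
        D.toSemiGraph.subdivision.Reachable n₀ (Sum.inr (Sum.inl ⟨e, he⟩))}⟩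
  have hC : φ.IsPreimageComponent H C := by
    refine ⟨isConnected_reachClass φ H w hwH, isGraph_reachClass φ H w hwH hprop hHg,
      ⟨w, hwH, SimpleGraph.Reachable.refl _⟩, fun u hu => hu.1, fun e he => he.1,
      fun K' hK' hK'V hK'E hVle hEle => ?_⟩
    have hsub := reachable_preimage_of_connected φ H K' hK' hK'V hK'E
      (hVle ⟨hwH, SimpleGraph.Reachable.refl _⟩)
    ext u
    · exact ⟨fun hu => ⟨hK'V hu, hsub.1 hu⟩, fun hu => hVle hu⟩
    · exact ⟨fun he => ⟨hK'E he, hsub.2 he⟩, fun he => hEle he⟩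
  have hKC : K = C := hK.eq_of_mem hC hw ⟨hwH, SimpleGraph.Reachable.refl _⟩
  rw [hKC]
  refine ⟨he, ?_⟩
  -- `w — b — e(b)` in the subdivision of the preimage
  have h1 : D.toSemiGraph.subdivision.Reachable n₀ (Sum.inr (Sum.inr ⟨b, he⟩)) :=
    (D.toSemiGraph.subdivision_reachable_branch_vertex
      ((Subgraph.abuts_eq_some_iff D ⟨b, he⟩ ⟨w, hwH⟩).mpr hb)).symm
  exact h1.trans (D.toSemiGraph.subdivision_reachable_edge_branch ⟨b, he⟩).symm

end SemiGraphOfAnabelioids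

end Literature.AnabelianGeometry.SemiGraphs
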